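import Mathlib
import HarnessLib
import Summits.CriticalPhenomena.SAWScalingLimit.Theses.SAWSpinMonotone
import Summits.CriticalPhenomena.SAWScalingLimit.Theses.SAWDevelopingMap
import Literature.Barriers.CriticalPhenomena.ParafermionicHalfCauchyRiemann
import Summits.CriticalPhenomena.SAWScalingLimit.Theorems.SAWSpinMonotoneQCIdentificationDefs
import Summits.CriticalPhenomena.SAWScalingLimit.Theorems.SAWSpinMonotoneQCIdentificationBoundaryPhaseLaw
import Summits.CriticalPhenomena.SAWScalingLimit.Theorems.SAWSpinMonotoneQCIdentificationRayRigidity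
import Summits.CriticalPhenomena.SAWScalingLimit.Theorems.SAWSpinMonotoneQCIdentificationNoBranching

/-!
# Line `eight_fifths_primitive` — Smirnov's primitive at spin 5/8 (ALT skeleton, crux-strategist)

Crux (FIXED, by name): `Summit.CriticalPhenomena.SAWScalingLimit.Theses.SAWSpinMonotone.QCIdentification`
`:= (K written out) → (M written out) → HexObservableLimit` (stmt-CriticalPhenomena-16772; one node with
stmt-8298 `SAWDevelopingMap.QCIdentification`, `sameNode : _ ↔ _ := Iff.rfl` below).

## The lever (new for this crux): the 1-form `Ξ := F^{8/5} dz` instead of the developing map `dH = F dz`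

Smirnov closed the Ising case (spin `σ = 1/2`) with the primitive `H = Im ∫ F² dz`, whose boundary values
are LATTICE-EXACT CONSTANTS on every discrete boundary, however rough. The spin-`σ` analogue is
`∫ F^{1/σ} dz`; at `σ = 5/8` this is `Φ_δ := ∫ F^{8/5} dz`, a 1-form on the edges of the triangulation `𝕋`
(hexagon centres) exactly like `H = ∫ F dz` (`PotentialExists`, landed). Two lattice facts drive the line:

* (R) EXACT BOUNDARY RAY, ANY MICROSTRUCTURE. On every boundary `𝕋`-edge (dual to a boundary mid-edge
  `p = {u,v}`, `v ∈ Λ`, `u ∉ Λ`) the winding of EVERY walk `a → p` is one number (discrete Umlaufsatz on the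
  face-disc `K_Λ`), so `F(p) = |F(p)| e^{-i(5/8)W_p}` and `F(p)^{8/5}·(x'-x) ∈ i e^{iΘ_in(a)} ℝ_{≥0}`:
  along `∂K_Λ` the primitive `Φ_δ` runs MONOTONICALLY ON ONE STRAIGHT RAY — a Dirichlet-type condition
  (`Im(e^{-iθ}Φ_δ) = κ` on the boundary) that is blind to Kennedy–Lawler boundary factors, staircase
  types and rough admissible collars. Branch-free eighth-power form = `BoundaryPhaseLaw` below
  (`F(p)^8 (c u - c v)^5 = -‖F(p)‖^8 (c u_a - c v_a)^5`, checked by exact enumeration to 1e-13 on balls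
  and random simply connected blobs, folder `exp/hexobs.py`).
* (Q) CLOSED TO SECOND ORDER. `Ξ` is not closed, but with `F_j = (S/3)(1 + ω^j a')` around a vertex
  (`Σ_j ω^j F_j = 0` is DCS Lemma 1, `a' = A'/S` the Beltrami mode, `|a'| ≤ k` under (K)) its circulation
  around `Δ_v` is `i e^{iθ₀} Σ_j ω^j F_j^{8/5} = 3 i e^{iθ₀} (S/3)^{8/5} [ (12/25) a'^2 + C₅ a'^5 + … ]`
  (only `n ≡ 2 mod 3` binomial terms survive; the LINEAR term is killed exactly by Lemma 1; confirmed
  numerically, next-term ratio `|C₅/C₂| = 0.0224`). Hence (M) makes `Φ_δ` asymptotically closed in the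
  bulk, and the entire boundary difficulty of the crux (the "twist" / boundary-factor balance of the
  birth line's `stub_boundaryRigidity`) becomes ONE quantitative interior quantity: the component,
  normal to the ray, of the boundary-LAYER circulation `Σ_{v near ∂} c_v`, `c_v ≈ (12/25)·3^{-3/5}
  S_v^{8/5} a_v'^2 dz` — quadratic in the Beltrami field, explicitly computable, zero by reflection for
  symmetric microstructures (zigzag, armchair).
* (L) LIOUVILLE END. If `G = lim Φ_δ = ∫ g^{8/5}` has ray boundary values and linear growth at the root,
  `Q := e^{-iθ} G∘Φ⁻¹ - iκ` is real on `ℝ`, entire after Schwarz reflection, `O(|w|)`: `Q = αw + β`, so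
  `g^{8/5} = α e^{iθ} Φ'` and `g = c e^{(5/8)(L - L_b)}` — `RayRigidity`, pure complex analysis, provable
  now (counterexample without growth: `Q = w³`, so the growth clause is necessary).

## The cut (seven registered stubs; `QCIdentification_of` composes them with a REAL proof)

Shared VERBATIM with the registered birth cut (`Lines/birth_SAWSpinMonotone.lean`, same signatures, so
one landed proof serves both lines): `stub_noBranching`, `stub_subsequentialLimits`,
`stub_lateralUniversality`, `stub_boundaryAmplitude`. The birth line's `stub_boundaryRigidity`
(oblique Riemann–Hilbert problem for `u = arg h' - (5/8) arg φ'` on general Jordan `D`) is REPLACED by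

* `stub_boundaryPhaseLaw : BoundaryPhaseLaw` — (R) in branch-free form; lattice, provable now (M/L:
  the discrete Umlaufsatz for `∂K_Λ`, in the tree only for strips `S_{T,L}` — triage r1 S2);
* `stub_rayCondition : BoundaryPhaseLaw → NoBranching → NoFoldBound → InteriorFlattening → RayCondition`
  — THE HARDEST STUB: every continuous, somewhere non-zero projective limit density `g` of the bulk
  averages is a `RaySolution` (holomorphic log, a primitive `G` of `g^{8/5}` with ray boundary values
  in the `Φ`-coordinate and linear growth `‖G‖ ≤ C(1 + ‖Φ‖)`). Content: (R) + branch consistency from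
  `NoBranching`/(K) + layer analysis of (Q) under (M) + the 45°-wedge normal form at the root;
* `stub_rayRigidity : RayRigidity` — (L); provable now (L-size formalisation: reflection principle).

`boundaryRigidity_of : RayCondition → RayRigidity → BoundaryRigidity` is a proved one-liner, after which
the birth line's proved glue (`projectiveShape_of`, `hexObservableLimit_of`, copied verbatim) and
`sameNode` conclude THIS route's crux by name.

## Honesty box (what the lever does NOT do)
Zero twist of every boundary microstructure is NECESSARY for the typed target (implant the
microstructure in an admissible `Λ_δ`), so no line removes it; here it sits inside `stub_rayCondition`
as "the layer circulation of `Ξ` is parallel to the ray", a quadratic lattice quantity with an explicit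
local formula (cheapest falsifier: transfer-matrix evaluation on a chiral digital staircase — see the
negation card `chiral-staircase-twist`). A rate in (M) may be needed for absolute summability of the
layer sum (`Σ_r ε(r)^2 < ∞`; numerics `ε(R) ~ R^{-0.6}` give it) — if so it is a `--supports` lemma of
`stub_rayCondition`, not a new item.

## Disproof used
No `Disproof.lean` exists for stmt-16772 (no cdisprove seat; `ledger crux ls`, 2026-08-17); the sibling's
cdisprove cycle 1 (stmt-8298 notes): sandwich `HexObservableLimit → QCIdentification`,
`¬QCIdentification ↔ K ∧ M ∧ ¬HexObservableLimit`, no `_false_without_<H>` — nothing to honour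
stub-wise; tightness `k ≥ β_T/α_T = 0.614` respected (no stub fixes `k`; (Q) is uniform in `|a'| ≤ k < 1`).
No landed `Theorems/QCIdentification/Negative/*`. Negatives 0772 / 5420 / 8312 / 8261 not restated
(`Admissible` = the repaired 14003 hypotheses verbatim).
-/

noncomputable section

open scoped BigOperators
open Literature.Probability.LatticeModels Literature.Probability.RandomPlanarGeometry
open Literature.Probability.RandomPlanarGeometry.SAW
open Literature.Barriers.CriticalPhenomena
open Summit.CriticalPhenomena.SAWScalingLimit.Theses.SAWDevelopingMap

namespace Summit.CriticalPhenomena.SAWScalingLimit.Cruxes.QCIdentification.EightFifthsPrimitive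

/-! ## 0–B. Vocabulary: LANDED as `Theorems/SAWSpinMonotoneQCIdentificationDefs.lean` (p165426) — `sameNode`,
`Fobs`, `hexNbr`, `modeSum`, `NoBranching`, `ZigzagLateralUniversality`, `Admissible`, `bulkAverage`,
`shapeIntegral`, `SubsequentialLimits`, `BoundaryRigidity`, `ProjectiveShape`, `BoundaryAmplitude`,
`BoundaryPhaseLaw`, `RaySolution`, `RayCondition`, `RayRigidity`, `Sig.stub_*` are imported from there
(texts byte-identical to the registered skeleton sha 8f8af967…). -/

/-! ## C. Registered stubs (the ONLY `sorry`s of the file) -/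

/-! **stub 1 — no branching under (K)** `stub_noBranching : NoFoldBound → NoBranching`: LANDED (p171025,
`Theorems/SAWSpinMonotoneQCIdentificationNoBranching.lean`, imported; combinatorial Gauss–Bonnet ledger for the
PL developing map: algebra/corners (…NoBranchingAlgebra/Corners), hexagon ledger S2 (…Hexagon), arc ledger S4
(…Arcs), boundary polar form S5 (…BoundaryPolar), boundary winding step law S6 (…StepLaw), corner regrouping
(…Stokes/CornerSites), runs/arc lift/telescope S7 (…NoBranchingRuns/ArcLift/Telescope)). -/

/-- **stub 2 — qc compactness + holomorphy** (shared verbatim with the birth cut). Size L/XL. -/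
theorem stub_subsequentialLimits :
    NoBranching → NoFoldBound → InteriorFlattening → SubsequentialLimits := by
  sorry

/-! **stub 3 — the exact boundary phase law** `stub_boundaryPhaseLaw : BoundaryPhaseLaw`: LANDED
(p166536, `Theorems/SAWSpinMonotoneQCIdentificationBoundaryPhaseLaw.lean`, imported; rigidity
`HexMidEdgeSAW.winding_eq_of_mem_boundary` + telescoping `exp_winding_mul_I`). -/

/-- **stub 4 — the ray condition** (see `RayCondition`). HARDEST; size XL. Consumes the boundary
ray (stub 3), branch consistency (`NoBranching`), (K) and (M). -/
theorem stub_rayCondition :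
    BoundaryPhaseLaw → NoBranching → NoFoldBound → InteriorFlattening → RayCondition := by
  sorry

/-! **stub 5 — ray rigidity** `stub_rayRigidity : RayRigidity`: LANDED (p166679,
`Theorems/SAWSpinMonotoneQCIdentificationRayRigidity.lean`, imported; reflection principle under `im f → 0`
(`Literature.Analysis.Complex.exists_differentiableOn_extension_of_tendsto_im`) + Cauchy estimate + Liouville +
continuous logarithm on the connected Jordan carrier). -/

/-- **stub 6 — (N1) lateral universality of the zigzag boundary layer** (shared verbatim). Size L. -/
theorem stub_lateralUniversality : ZigzagLateralUniversality := by
  sorry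

/-- **stub 7 — the boundary amplitude at the flat rigid row** (shared verbatim). Size L. -/
theorem stub_boundaryAmplitude :
    NoBranching → NoFoldBound → InteriorFlattening → ZigzagLateralUniversality →
      BoundaryAmplitude := by
  sorry

/-! ## D. Proved reductions shared with the birth line (copied verbatim; no `sorry`) -/

/-- Compactness + rigidity ⇒ projective shape convergence along subsequences, with the right limit. -/
theorem projectiveShape_of (hC : SubsequentialLimits) (hR : BoundaryRigidity) : ProjectiveShape := by
  intro D ρ Λ m a b Φ L Lb hadm δs hδs
  obtain ⟨φ, hφ, ν, g, hg, ⟨z₀, hz₀, hgz₀⟩, hν⟩ := hC D ρ Λ m a b Φ L Lb hadm δs hδs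
  obtain ⟨c, hc⟩ := hR D ρ Λ m a b Φ L Lb hadm g hg.continuousOn ⟨z₀, hz₀, hgz₀⟩
    ⟨fun n => δs (φ n), hδs.comp hφ.tendsto_atTop, ν, hν⟩
  have hc0 : c ≠ 0 := by
    rintro rfl
    exact hgz₀ (by simpa using hc z₀ hz₀)
  refine ⟨φ, hφ, fun n => c⁻¹ * ν n, fun ψ hψ hψc hψs => ?_⟩
  have hint : (∫ z, ψ z * g z) = c * shapeIntegral L Lb ψ := by
    rw [shapeIntegral, ← MeasureTheory.integral_const_mul]
    congr 1
    funext z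
    by_cases hz : z ∈ D.carrier
    · rw [hc z hz]; ring
    · have h0 : ψ z = 0 := image_eq_zero_of_notMem_tsupport fun h => hz (hψs h)
      simp [h0]
  have h1 := (hν ψ hψ hψc hψs).const_mul c⁻¹
  rw [hint, ← mul_assoc, inv_mul_cancel₀ hc0, one_mul] at h1
  simpa only [mul_assoc] using h1

/-- Shape + amplitude ⇒ the target, along the full filter `𝓝[>] 0`, with `c = κ⁻¹`. -/
theorem hexObservableLimit_of (hS : ProjectiveShape) (hA : BoundaryAmplitude) :
    HexObservableLimit := by
  obtain ⟨κ, hκ, hA⟩ := hA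
  refine ⟨κ⁻¹, inv_ne_zero hκ, ?_⟩
  intro D ρ Λ m a b Φ L Lb ψ
  dsimp only
  intro hρ hflat hev hexh ha hb hΦa hΦb hL hexpL hLb hψ hψc hψs
  have hadm : Admissible D ρ Λ m a b Φ L Lb :=
    ⟨hρ, hflat, hev, hexh, ha, hb, hΦa, hΦb, hL, hexpL, hLb⟩
  refine Filter.tendsto_of_subseq_tendsto fun δs hδs => ?_
  obtain ⟨φ, hφ, ν, hν⟩ := hS D ρ Λ m a b Φ L Lb hadm δs hδs
  refine ⟨φ, ?_⟩
  have hb' : Filter.Tendsto (fun n => ν n * Fobs (Λ (δs (φ n))) (a (δs (φ n))) (b (δs (φ n))))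
      Filter.atTop (nhds κ) :=
    hA D ρ Λ m a b Φ L Lb hadm (fun n => δs (φ n)) (hδs.comp hφ.tendsto_atTop) ν hν
  have hψ' := hν ψ hψ hψc hψs
  have hne : ∀ᶠ n in Filter.atTop, ν n ≠ 0 :=
    (hb'.eventually_ne hκ).mono fun n h => left_ne_zero_of_mul h
  have key : Filter.Tendsto (fun n => bulkAverage Λ a ψ (δs (φ n)) /
      Fobs (Λ (δs (φ n))) (a (δs (φ n))) (b (δs (φ n)))) Filter.atTop
      (nhds (shapeIntegral L Lb ψ / κ)) := by
    refine (hψ'.div hb' hκ).congr' ?_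
    filter_upwards [hne] with n hn
    simp only [Pi.div_apply]
    rw [mul_div_mul_left _ _ hn]
  rw [div_eq_inv_mul] at key
  simpa only [bulkAverage, Fobs, shapeIntegral] using key



/-! ## E. New proved glue: ray condition + ray rigidity ⇒ the birth line's `BoundaryRigidity` -/

/-- Smirnov-form identification: `RayCondition` and `RayRigidity` give `BoundaryRigidity` (the
conclusion of the birth line's hardest stub), by composition. -/
theorem boundaryRigidity_of (hC : RayCondition) (hR : RayRigidity) : BoundaryRigidity :=
  fun D ρ Λ m a b Φ L Lb hadm g hg hnz hlim =>
    hR D ρ Λ m a b Φ L Lb hadm g (hC D ρ Λ m a b Φ L Lb hadm g hg hnz hlim)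

/-! ## F. Composition (kernel-checked): the four OPEN stubs + the three LANDED ones close THIS ROUTE's crux BY NAME -/

/-- **`SAWSpinMonotone.QCIdentification` from the stubs.** `sorryAx` enters only through the four
open `stub_*`; the landed `stub_noBranching` (p171025), `stub_boundaryPhaseLaw` (p166536) and
`stub_rayRigidity` (p166679) are imported theorems. No branching and compactness give subsequential holomorphic limits; the boundary
phase law feeds the ray condition, which with ray rigidity identifies every limit density
(`boundaryRigidity_of`), hence the projective shape; (N1) and the boundary amplitude normalise at
`b`; `sameNode` retargets the shared conclusion to THIS route's decl. -/
theorem QCIdentification_of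
    (h₂ : Sig.stub_subsequentialLimits)
    (h₄ : Sig.stub_rayCondition) (h₆ : Sig.stub_lateralUniversality)
    (h₇ : Sig.stub_boundaryAmplitude) :
    Summit.CriticalPhenomena.SAWScalingLimit.Theses.SAWSpinMonotone.QCIdentification :=
  sameNode.mpr fun hK hM =>
    have hB : NoBranching := stub_noBranching hK
    hexObservableLimit_of
      (projectiveShape_of (h₂ hB hK hM)
        (boundaryRigidity_of (h₄ stub_boundaryPhaseLaw hB hK hM) stub_rayRigidity))
      (h₇ hB hK hM h₆)

/-- **The line as it stands** (the shape the skeleton checker registers): the crux BY NAME from the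
four open registered stubs and the three landed ones. -/
theorem QCIdentification_proof :
    Summit.CriticalPhenomena.SAWScalingLimit.Theses.SAWSpinMonotone.QCIdentification :=
  QCIdentification_of stub_subsequentialLimits stub_rayCondition
    stub_lateralUniversality stub_boundaryAmplitude

end Summit.CriticalPhenomena.SAWScalingLimit.Cruxes.QCIdentification.EightFifthsPrimitive
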